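import Summits.CriticalPhenomena.Ising3DConformalLimit.Theorems.IsingEuclidUpgradeIsingEuclidUpgradeR2RotInvPowerLawConverses
import Summits.CriticalPhenomena.Ising3DConformalLimit.Theorems.IsingEuclidUpgradeIsingEuclidUpgradeR2RotInvPowerLawZoomMonotoneLink
import Summits.CriticalPhenomena.Ising3DConformalLimit.Theorems.IsingEuclidUpgradeIsingEuclidUpgradeR2RotInvPowerLawScalingLaws
import Summits.CriticalPhenomena.Ising3DConformalLimit.Theorems.IsingEuclidUpgradeIsingEuclidUpgradeR2RotInvPowerLawTowerOfDini
import Summits.CriticalPhenomena.Ising3DConformalLimit.Theorems.IsingEuclidUpgradeIsingEuclidUpgradeR2RotInvPowerLawUpstreams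
import HarnessLib

/-!
# Crux `IsingEuclidUpgradeR2RotInvPowerLaw` (stmt-CriticalPhenomena-0634) — line `tower_profile_rigidity`,
# skeleton v5 (lead c1 = `prover-line-stmt-CriticalPhenomena-0634-c1-0`, cycle 3, 2026-08-17)

Write `G := criticalTwoPoint 3` (critical two-point function `⟨σ₀σ_x⟩_{β_c}` of the nearest-neighbour Ising model
on `ℤ³`), `g(n) := G(n e₀)`, `|x|₂ := √(∑ xᵢ²)`. The crux r2: `∃ Δ c > 0, G(x)|x|₂^{2Δ} → c` cofinitely.

STATE AFTER CYCLE 2 OF LEAD c1.  Every TRANSFER of the line is a LANDED theorem; the `sorry`s left are bare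
existence-of-limit statements about `G` (the open axial problem; Duminil-Copin, ICM 2022, §8.1/§8.4) plus ONE
named milestone of another route:

* T1  `stub_dyadicTowerLaw`    — one tower converges: `∃ Δ c > 0, g(2^j)(2^j)^{2Δ} → c` (PURITY);
* S2  `stub_integerDilationLaw` — `∃ Δ ∀ k ≥ 1, g(kn)k^{2Δ}/g(n) → 1` (regular variation of the axis sequence);
* V   `stub_vagueIsotropy`      — item stmt-CriticalPhenomena-6036 `Theses.HarmonicMomentsIsotropy.TwoPointAsymptoticIsotropy`
  BY NAME (vague `O(3)`-asymptotic isotropy; implied by items 6034 ∧ 6032 through the landed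
  `twoPointAsymptoticIsotropy_of_harmonicDilution_window`);
* the older companions Sray `stub_rayDilationLaw`, A_rays `stub_rayProfiles`, T3 `stub_triadicScalingLaw`,
  D2 `stub_dyadicScalingLaw` (= item 6323 verbatim) of variants Q / P′ / P″.

NEW IN CYCLE 2 (all `--supports stmt-CriticalPhenomena-0634`, namespace `…Cruxes.IsingEuclidUpgradeR2RotInvPowerLaw.TowerProfileRigidity`):
* VARIANT V (`…VagueKernel` p173029, `…VagueToRays` p173133): **S2 ∧ V ⇒ Sray** (`rayDilationLaw_of_dilationLaw_of_vague`):
  V makes every cluster kernel of the pinned pair zoom `O(3)`-invariant (sequential bulk Riemann sums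
  `tendsto_scaled_latticeSum_seq` p172382 + du Bois-Reymond off the origin `kernel_isometry_invariant_of_integrals`
  p172600), S2 pins the axis values (`kernel_axis_rpow_of_dilationLawAt`, `uniformRegularity_of_dilationLaw` p172575),
  so the kernel is `‖·‖^{-2Δ}`, the cluster point is unique (`pairLimit_of_dilationLaw_of_vague`) and
  `rayRV_of_pairLimit` gives Sray.  LOSSLESS: **r2 ⟺ T1 ∧ S2 ∧ V ⟺ D1 ∧ V**
  (`rotInvPowerLaw_iff_towerLaw_and_dilationLaw_and_vague`, `rotInvPowerLaw_iff_axisPowerLaw_and_vague`).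
* HELSON LINK (`…HelsonLink` p172806): items 18121 `AxialHelsonCone` ∧ 4662 `EtaBoundsExist` ⇒ D1 ⇒ T1 ∧ S2
  (`axisPowerLaw_of_axialHelsonCone_of_etaBounds`; proves `Theses.HelsonAxis.HelsonForcing` = item 17972 verbatim).
* KARAMATA LINK (`…KaramataLink` p172523): item 5047 `TwoPointRegularVariation` ⇒ S2 and ⇒ D2.
* Corollaries: r2 ⟸ T1 ∧ S2 ∧ 6034 ∧ 6032; r2 ⟸ 18121 ∧ 4662 ∧ 6036; V ⇒ `Theses.HelsonAxis.AxisToIsotropicLaw`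
  (item 17971).
NEW IN CYCLE 3:
* MONOTONE-RG LINK (`…ZoomMonotoneLink` p173967): item 14454 `MonotoneRG.ZoomMonotone` ⇒ Sray (through the tree's
  `crux_of_zoomMonotone` : 14454 ⇒ 1981); 14454 ∧ 4662 ⇒ T1 (eventually monotone dyadic ratio + two-sided bounds ⇒ the tower
  converges); hence **14454 ∧ 4662 ⇒ r2** (`IsingEuclidUpgradeR2RotInvPowerLaw_of_zoomMonotone_of_etaBounds`).
* CONVERSES (`…Converses` p174063): r2 ⇒ 4662 `EtaBoundsExist` and r2 ⇒ 5047 `TwoPointRegularVariation` (so the Helson and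
  Karamata links lose nothing on those legs); **r2 ⟺ T1 ∧ 5047 ∧ V**.

EARLIER (predecessor lead, cycle 1): Rray p165602, R p166324, U p166524, AXIS × ANGLE glue p166097, TOWER × RAYS glue
p166774 (r2 ⟺ T1 ∧ Sray), RayProfiles p167263 (r2 ⟺ T1 ∧ S2 ∧ A_rays), TwoDilations p167268 (S2 ⟸ D2 ∧ T3),
TowerOfDini p167127 (S1 ⇒ T1), Upstreams p167508 (4495 ⇒ T1, 1981/6153 ⇒ Sray, S3 ⇒ A_rays), ScalingLaws p167790.

Failure modes (Disproof.lean F2/F3/F2′, landed `Negative/*`): a drifting slowly varying factor violates exactly T1;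
a log-periodic factor violates exactly S2 (even with axis RP and complete monotonicity); both are properties of
the axis sequence `g` alone, so the residue of the crux proper is the AXIAL law D1 ⟺ T1 ∧ S2; isotropy is
outsourced to V (route HarmonicMomentsIsotropy) or to Sray/A_rays.
-/

noncomputable section

namespace Summit.CriticalPhenomena.Ising3DConformalLimit.Cruxes.IsingEuclidUpgradeR2RotInvPowerLaw.TowerProfileRigidity

open Filter Topology Literature.Probability.LatticeModels

/-! ## The open stubs (the only `sorry`s) -/

/-- **T1 (dyadic tower law)** — OPEN (implied by the crux: `towerLaw_of_rotInvPowerLaw`; implied by D1: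
`towerLaw_of_axisPowerLaw`; by items 18121 ∧ 4662: `axisPowerLaw_of_axialHelsonCone_of_etaBounds`; by item 4495:
`towerLaw_of_inverseSquareLaw`; by the rate stub S1: `towerLaw_of_dyadicDiniLaw`). -/
theorem stub_dyadicTowerLaw :
    ∃ Δ c : ℝ, 0 < c ∧ Filter.Tendsto (fun j : ℕ => Literature.Probability.LatticeModels.criticalTwoPoint 3 (Pi.single 0 ((2 ^ j : ℕ) : ℤ)) * ((2 ^ j : ℕ) : ℝ) ^ (2 * Δ)) Filter.atTop (nhds c) := by
  sorry

/-- **S2 (integer dilation law on the axis)** — OPEN (implied by the crux: `dilationLaw_of_rotInvPowerLaw`; by D1: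
`dilationLaw_of_axisPowerLaw`; by item 5047: `integerDilationLaw_of_twoPointRegularVariation`; = D2 ∧ T3:
`integerDilationLaw_of_dyadicScalingLaw_of_triadicScalingLaw`). -/
theorem stub_integerDilationLaw :
    ∃ Δ : ℝ, ∀ k : ℕ, 1 ≤ k → Filter.Tendsto (fun n : ℕ => Literature.Probability.LatticeModels.criticalTwoPoint 3 (Pi.single 0 ((k * n : ℕ) : ℤ)) * (k : ℝ) ^ (2 * Δ) / Literature.Probability.LatticeModels.criticalTwoPoint 3 (Pi.single 0 ((n : ℕ) : ℤ))) Filter.atTop (nhds 1) := by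
  sorry

/-- **V (vague asymptotic isotropy)** — OPEN; BY NAME the statement of item stmt-CriticalPhenomena-6036
`Theses.HarmonicMomentsIsotropy.TwoPointAsymptoticIsotropy` (milestone of route HarmonicMomentsIsotropy, shared here
as a stub so that its landing propagates; implied by the crux: `twoPointAsymptoticIsotropy_of_rotInvPowerLaw`;
by items 6034 ∧ 6032: `twoPointAsymptoticIsotropy_of_harmonicDilution_window`; by ray regular variation:
`twoPointAsymptoticIsotropy_of_rayRegularVariation`). -/
theorem stub_vagueIsotropy :
    Summit.CriticalPhenomena.Ising3DConformalLimit.Theses.HarmonicMomentsIsotropy.TwoPointAsymptoticIsotropy := by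
  sorry

/-- **Sray (ray dilation law)** — OPEN (variant Q; = S2 ∧ V: `rayDilationLaw_of_dilationLaw_of_vague`; = S2 ∧ A_rays
given U: `rayLawAt_of_dilationLawAt_of_rayProfiles`; implied by the crux: `rayLaw_of_rotInvPowerLaw`). -/
theorem stub_rayDilationLaw :
    ∃ Δ : ℝ, ∀ v : Literature.Probability.LatticeModels.Site 3, v ≠ 0 → ∀ k : ℕ, 1 ≤ k → Filter.Tendsto (fun n : ℕ => Literature.Probability.LatticeModels.criticalTwoPoint 3 (((k * n : ℕ) : ℤ) • v) * (k : ℝ) ^ (2 * Δ) / Literature.Probability.LatticeModels.criticalTwoPoint 3 (((n : ℕ) : ℤ) • v)) Filter.atTop (nhds 1) := by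
  sorry

/-- **A_rays (ray-wise angular ratio exists)** — OPEN (variant P′; implied by the crux with `c_v = 1`:
`rayProfiles_of_rotInvPowerLaw`). -/
theorem stub_rayProfiles :
    ∀ v : Literature.Probability.LatticeModels.Site 3, v ≠ 0 → ∃ c : ℝ, 0 < c ∧ Filter.Tendsto (fun n : ℕ => Literature.Probability.LatticeModels.criticalTwoPoint 3 (((n : ℕ) : ℤ) • v) / Literature.Probability.LatticeModels.criticalTwoPoint 3 (Pi.single 0 ((⌊(n : ℝ) * Real.sqrt (∑ i, ((v i : ℝ)) ^ 2)⌋₊ : ℕ) : ℤ))) Filter.atTop (nhds c) := by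
  sorry

/-- **T3 (triadic scaling law on the axis)** — OPEN (variant P″; with D2 it GIVES S2:
`integerDilationLaw_of_dyadicScalingLaw_of_triadicScalingLaw`). -/
theorem stub_triadicScalingLaw :
    ∃ Δ' : ℝ, Filter.Tendsto (fun n : ℕ => Literature.Probability.LatticeModels.criticalTwoPoint 3 (Pi.single 0 ((3 * n : ℕ) : ℤ)) * (9 : ℝ) ^ Δ' / Literature.Probability.LatticeModels.criticalTwoPoint 3 (Pi.single 0 ((n : ℕ) : ℤ))) Filter.atTop (nhds 1) := by
  sorry

/-- **D2 (dyadic scaling law on the axis)** — OPEN; VERBATIM the statement of item stmt-CriticalPhenomena-6323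
`Theses.ThresholdDilation.DyadicScalingLaw` (implied by item 5047: `dyadicScalingLaw_of_twoPointRegularVariation`). -/
theorem stub_dyadicScalingLaw :
    ∃ Δ : ℝ, 0 < Δ ∧ Filter.Tendsto (fun n : ℕ => Literature.Probability.LatticeModels.criticalTwoPoint 3 (Pi.single 0 ((2 * n : ℕ) : ℤ)) * (4 : ℝ) ^ Δ / Literature.Probability.LatticeModels.criticalTwoPoint 3 (Pi.single 0 ((n : ℕ) : ℤ))) Filter.atTop (nhds 1) := by
  sorry

/-! ## Aliases keyed by the registered stub names (so that the compositions' hypotheses are typed BY NAME) -/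
namespace __Registered

/-- Alias of the registered stub `stub_dyadicTowerLaw` (same text). -/
abbrev stub_dyadicTowerLaw : Prop :=
  ∃ Δ c : ℝ, 0 < c ∧ Filter.Tendsto (fun j : ℕ => Literature.Probability.LatticeModels.criticalTwoPoint 3 (Pi.single 0 ((2 ^ j : ℕ) : ℤ)) * ((2 ^ j : ℕ) : ℝ) ^ (2 * Δ)) Filter.atTop (nhds c)

/-- Alias of the registered stub `stub_integerDilationLaw` (same text). -/
abbrev stub_integerDilationLaw : Prop :=
  ∃ Δ : ℝ, ∀ k : ℕ, 1 ≤ k → Filter.Tendsto (fun n : ℕ => Literature.Probability.LatticeModels.criticalTwoPoint 3 (Pi.single 0 ((k * n : ℕ) : ℤ)) * (k : ℝ) ^ (2 * Δ) / Literature.Probability.LatticeModels.criticalTwoPoint 3 (Pi.single 0 ((n : ℕ) : ℤ))) Filter.atTop (nhds 1)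

/-- Alias of the registered stub `stub_vagueIsotropy` (the route decl of item 6036, by name). -/
abbrev stub_vagueIsotropy : Prop :=
  Summit.CriticalPhenomena.Ising3DConformalLimit.Theses.HarmonicMomentsIsotropy.TwoPointAsymptoticIsotropy

/-- Alias of the registered stub `stub_rayDilationLaw` (same text). -/
abbrev stub_rayDilationLaw : Prop :=
  ∃ Δ : ℝ, ∀ v : Literature.Probability.LatticeModels.Site 3, v ≠ 0 → ∀ k : ℕ, 1 ≤ k → Filter.Tendsto (fun n : ℕ => Literature.Probability.LatticeModels.criticalTwoPoint 3 (((k * n : ℕ) : ℤ) • v) * (k : ℝ) ^ (2 * Δ) / Literature.Probability.LatticeModels.criticalTwoPoint 3 (((n : ℕ) : ℤ) • v)) Filter.atTop (nhds 1)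

/-- Alias of the registered stub `stub_rayProfiles` (same text). -/
abbrev stub_rayProfiles : Prop :=
  ∀ v : Literature.Probability.LatticeModels.Site 3, v ≠ 0 → ∃ c : ℝ, 0 < c ∧ Filter.Tendsto (fun n : ℕ => Literature.Probability.LatticeModels.criticalTwoPoint 3 (((n : ℕ) : ℤ) • v) / Literature.Probability.LatticeModels.criticalTwoPoint 3 (Pi.single 0 ((⌊(n : ℝ) * Real.sqrt (∑ i, ((v i : ℝ)) ^ 2)⌋₊ : ℕ) : ℤ))) Filter.atTop (nhds c)

/-- Alias of the registered stub `stub_triadicScalingLaw` (same text). -/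
abbrev stub_triadicScalingLaw : Prop :=
  ∃ Δ' : ℝ, Filter.Tendsto (fun n : ℕ => Literature.Probability.LatticeModels.criticalTwoPoint 3 (Pi.single 0 ((3 * n : ℕ) : ℤ)) * (9 : ℝ) ^ Δ' / Literature.Probability.LatticeModels.criticalTwoPoint 3 (Pi.single 0 ((n : ℕ) : ℤ))) Filter.atTop (nhds 1)

/-- Alias of the registered stub `stub_dyadicScalingLaw` (same text). -/
abbrev stub_dyadicScalingLaw : Prop :=
  ∃ Δ : ℝ, 0 < Δ ∧ Filter.Tendsto (fun n : ℕ => Literature.Probability.LatticeModels.criticalTwoPoint 3 (Pi.single 0 ((2 * n : ℕ) : ℤ)) * (4 : ℝ) ^ Δ / Literature.Probability.LatticeModels.criticalTwoPoint 3 (Pi.single 0 ((n : ℕ) : ℤ))) Filter.atTop (nhds 1)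

end __Registered

/-! ## Variant V (live): T1 ∧ S2 ∧ V conclude the crux BY NAME (glue landed, p173133) -/

/-- **Skeleton theorem, variant V (kernel-checked modulo the three stubs).** `T1 → S2 → V → r2` is the landed
glue `IsingEuclidUpgradeR2RotInvPowerLaw_of_towerLaw_of_dilationLaw_of_vague`. -/
theorem IsingEuclidUpgradeR2RotInvPowerLaw_of
    (h1 : __Registered.stub_dyadicTowerLaw)
    (h2 : __Registered.stub_integerDilationLaw)
    (hV : __Registered.stub_vagueIsotropy) :
    Summit.CriticalPhenomena.Ising3DConformalLimit.Theses.IsingEuclidUpgrade.IsingEuclidUpgradeR2RotInvPowerLaw :=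
  IsingEuclidUpgradeR2RotInvPowerLaw_of_towerLaw_of_dilationLaw_of_vague h1 h2 hV

/-- The crux from the registered stubs of variant V, applied literally (sorry-free once T1, S2 and V land). -/
theorem IsingEuclidUpgradeR2RotInvPowerLaw_of_stubs :
    Summit.CriticalPhenomena.Ising3DConformalLimit.Theses.IsingEuclidUpgrade.IsingEuclidUpgradeR2RotInvPowerLaw :=
  IsingEuclidUpgradeR2RotInvPowerLaw_of stub_dyadicTowerLaw stub_integerDilationLaw stub_vagueIsotropy

/-- The bet route's copy (item 0634 on route PrecisionLaplacian, rank 7): same proposition, same three stubs. -/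
theorem PrecisionLaplacian_IsingEuclidUpgradeR2RotInvPowerLaw_of_stubs :
    Summit.CriticalPhenomena.Ising3DConformalLimit.Theses.PrecisionLaplacian.IsingEuclidUpgradeR2RotInvPowerLaw :=
  IsingEuclidUpgradeR2RotInvPowerLaw_of stub_dyadicTowerLaw stub_integerDilationLaw stub_vagueIsotropy

/-! ## Variant Q: T1 ∧ Sray conclude the crux BY NAME (glue landed, p166774) -/

/-- **Skeleton theorem, variant Q.** `T1 → Sray → r2`. -/
theorem IsingEuclidUpgradeR2RotInvPowerLaw_of_rays
    (h1 : __Registered.stub_dyadicTowerLaw)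
    (h2 : __Registered.stub_rayDilationLaw) :
    Summit.CriticalPhenomena.Ising3DConformalLimit.Theses.IsingEuclidUpgrade.IsingEuclidUpgradeR2RotInvPowerLaw :=
  IsingEuclidUpgradeR2RotInvPowerLaw_of_towerLaw_of_rayLaw h1 h2

/-- Variant Q from the registered stubs, applied literally. -/
theorem IsingEuclidUpgradeR2RotInvPowerLaw_of_rays_stubs :
    Summit.CriticalPhenomena.Ising3DConformalLimit.Theses.IsingEuclidUpgrade.IsingEuclidUpgradeR2RotInvPowerLaw :=
  IsingEuclidUpgradeR2RotInvPowerLaw_of_rays stub_dyadicTowerLaw stub_rayDilationLaw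

/-! ## Variant P′: T1 ∧ S2 ∧ A_rays (glue landed, p167263); variant P″: T1 ∧ D2 ∧ T3 ∧ A_rays (p167268 + p167263) -/

/-- **Skeleton theorem, variant P′.** `T1 → S2 → A_rays → r2`. -/
theorem IsingEuclidUpgradeR2RotInvPowerLaw_of_profiles
    (h1 : __Registered.stub_dyadicTowerLaw)
    (h2 : __Registered.stub_integerDilationLaw)
    (h3 : __Registered.stub_rayProfiles) :
    Summit.CriticalPhenomena.Ising3DConformalLimit.Theses.IsingEuclidUpgrade.IsingEuclidUpgradeR2RotInvPowerLaw :=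
  IsingEuclidUpgradeR2RotInvPowerLaw_of_towerLaw_of_dilationLaw_of_rayProfiles h1 h2 h3

/-- **Skeleton theorem, variant P″.** `T1 → D2 (item 6323) → T3 → A_rays → r2`. -/
theorem IsingEuclidUpgradeR2RotInvPowerLaw_of_dyadicScalingLaw
    (h1 : __Registered.stub_dyadicTowerLaw)
    (hD2 : __Registered.stub_dyadicScalingLaw)
    (hT3 : __Registered.stub_triadicScalingLaw)
    (h3 : __Registered.stub_rayProfiles) :
    Summit.CriticalPhenomena.Ising3DConformalLimit.Theses.IsingEuclidUpgrade.IsingEuclidUpgradeR2RotInvPowerLaw :=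
  IsingEuclidUpgradeR2RotInvPowerLaw_of_profiles h1
    (integerDilationLaw_of_dyadicScalingLaw_of_triadicScalingLaw hD2 hT3) h3

/-- Variants P′ / P″ from the registered stubs, applied literally. -/
theorem IsingEuclidUpgradeR2RotInvPowerLaw_of_dyadicScalingLaw_stubs :
    Summit.CriticalPhenomena.Ising3DConformalLimit.Theses.IsingEuclidUpgrade.IsingEuclidUpgradeR2RotInvPowerLaw :=
  IsingEuclidUpgradeR2RotInvPowerLaw_of_dyadicScalingLaw stub_dyadicTowerLaw stub_dyadicScalingLaw stub_triadicScalingLaw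
    stub_rayProfiles

/-! ## Sanity: the splits are lossless (landed `iff`s), and the recorded upstream reductions typecheck -/

/-- r2 ⟺ T1 ∧ S2 ∧ V (landed p173133). -/
example : Summit.CriticalPhenomena.Ising3DConformalLimit.Theses.IsingEuclidUpgrade.IsingEuclidUpgradeR2RotInvPowerLaw ↔
    (__Registered.stub_dyadicTowerLaw ∧ __Registered.stub_integerDilationLaw ∧ __Registered.stub_vagueIsotropy) :=
  rotInvPowerLaw_iff_towerLaw_and_dilationLaw_and_vague

/-- r2 ⟺ D1 ∧ V (landed p173133): the crux is "axial pure power law + vague isotropy". -/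
example : Summit.CriticalPhenomena.Ising3DConformalLimit.Theses.IsingEuclidUpgrade.IsingEuclidUpgradeR2RotInvPowerLaw ↔
    ((∃ Δ c : ℝ, 0 < c ∧ Filter.Tendsto (fun n : ℕ => Literature.Probability.LatticeModels.criticalTwoPoint 3 (Pi.single 0 ((n : ℕ) : ℤ)) * (n : ℝ) ^ (2 * Δ)) Filter.atTop (nhds c)) ∧
      __Registered.stub_vagueIsotropy) :=
  rotInvPowerLaw_iff_axisPowerLaw_and_vague

/-- r2 ⟺ T1 ∧ Sray (landed p166774). -/
example : Summit.CriticalPhenomena.Ising3DConformalLimit.Theses.IsingEuclidUpgrade.IsingEuclidUpgradeR2RotInvPowerLaw ↔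
    (__Registered.stub_dyadicTowerLaw ∧ __Registered.stub_rayDilationLaw) :=
  rotInvPowerLaw_iff_towerLaw_and_rayLaw

/-- UPSTREAMS of T1 ∧ S2: items 18121 `AxialHelsonCone` ∧ 4662 `EtaBoundsExist` (route HelsonAxis) give D1, hence
T1 and S2 (landed p172806). -/
example (hH : Summit.CriticalPhenomena.Ising3DConformalLimit.Theses.HelsonAxis.AxialHelsonCone)
    (hE : Summit.CriticalPhenomena.Ising3DConformalLimit.Theses.HelsonAxis.EtaBoundsExist) :
    __Registered.stub_dyadicTowerLaw ∧ __Registered.stub_integerDilationLaw :=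
  ⟨towerLaw_of_axisPowerLaw (axisPowerLaw_of_axialHelsonCone_of_etaBounds hH hE),
    dilationLaw_of_axisPowerLaw (axisPowerLaw_of_axialHelsonCone_of_etaBounds hH hE)⟩

/-- UPSTREAM of S2 and D2: item 5047 `TwoPointRegularVariation` (route BallOrbitComparison; landed p172523). -/
example (h : Summit.CriticalPhenomena.Ising3DConformalLimit.Theses.BallOrbitComparison.TwoPointRegularVariation) :
    __Registered.stub_integerDilationLaw ∧ __Registered.stub_dyadicScalingLaw :=
  ⟨integerDilationLaw_of_twoPointRegularVariation h, dyadicScalingLaw_of_twoPointRegularVariation h⟩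

/-- UPSTREAM of V: items 6034 `HarmonicDilution` ∧ 6032 `CorrelationLengthWindow` (route HarmonicMomentsIsotropy),
so that T1 ∧ S2 ∧ 6034 ∧ 6032 ⇒ r2 (landed p173133). -/
example (h1 : __Registered.stub_dyadicTowerLaw) (h2 : __Registered.stub_integerDilationLaw)
    (hHD : Summit.CriticalPhenomena.Ising3DConformalLimit.Theses.HarmonicMomentsIsotropy.HarmonicDilution)
    (hCLW : Summit.CriticalPhenomena.Ising3DConformalLimit.Theses.HarmonicMomentsIsotropy.CorrelationLengthWindow) :
    Summit.CriticalPhenomena.Ising3DConformalLimit.Theses.IsingEuclidUpgrade.IsingEuclidUpgradeR2RotInvPowerLaw :=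
  IsingEuclidUpgradeR2RotInvPowerLaw_of_towerLaw_of_dilationLaw_of_harmonicDilution_of_window h1 h2 hHD hCLW

/-- The four mechanism items of routes HelsonAxis and HarmonicMomentsIsotropy conclude the crux (landed p173133). -/
example (hH : Summit.CriticalPhenomena.Ising3DConformalLimit.Theses.HelsonAxis.AxialHelsonCone)
    (hE : Summit.CriticalPhenomena.Ising3DConformalLimit.Theses.HelsonAxis.EtaBoundsExist)
    (hHD : Summit.CriticalPhenomena.Ising3DConformalLimit.Theses.HarmonicMomentsIsotropy.HarmonicDilution)
    (hCLW : Summit.CriticalPhenomena.Ising3DConformalLimit.Theses.HarmonicMomentsIsotropy.CorrelationLengthWindow) :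
    Summit.CriticalPhenomena.Ising3DConformalLimit.Theses.IsingEuclidUpgrade.IsingEuclidUpgradeR2RotInvPowerLaw :=
  IsingEuclidUpgradeR2RotInvPowerLaw_of_axialHelsonCone_of_etaBounds_of_vague hH hE
    (Summit.CriticalPhenomena.Ising3DConformalLimit.HarmonicMomentsIsotropyTwoPoint.twoPointAsymptoticIsotropy_of_harmonicDilution_window
      hHD hCLW)

/-- UPSTREAM: item 14454 `MonotoneRG.ZoomMonotone` gives Sray, and with item 4662 also T1, hence the crux (landed p173967). -/
example (hZ : Summit.CriticalPhenomena.Ising3DConformalLimit.Theses.MonotoneRG.ZoomMonotone)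
    (hE : Summit.CriticalPhenomena.Ising3DConformalLimit.Theses.HelsonAxis.EtaBoundsExist) :
    __Registered.stub_rayDilationLaw ∧ __Registered.stub_dyadicTowerLaw ∧
      Summit.CriticalPhenomena.Ising3DConformalLimit.Theses.IsingEuclidUpgrade.IsingEuclidUpgradeR2RotInvPowerLaw :=
  ⟨rayDilationLaw_of_zoomMonotone hZ, towerLaw_of_zoomMonotone_of_etaBounds hZ hE,
    IsingEuclidUpgradeR2RotInvPowerLaw_of_zoomMonotone_of_etaBounds hZ hE⟩

/-- CONVERSES (landed p174063): the crux implies items 4662 and 5047; r2 ⟺ T1 ∧ 5047 ∧ V. -/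
example (h : Summit.CriticalPhenomena.Ising3DConformalLimit.Theses.IsingEuclidUpgrade.IsingEuclidUpgradeR2RotInvPowerLaw) :
    Summit.CriticalPhenomena.Ising3DConformalLimit.Theses.HelsonAxis.EtaBoundsExist ∧
      Summit.CriticalPhenomena.Ising3DConformalLimit.Theses.BallOrbitComparison.TwoPointRegularVariation :=
  ⟨etaBoundsExist_of_rotInvPowerLaw h, twoPointRegularVariation_of_rotInvPowerLaw h⟩

example : Summit.CriticalPhenomena.Ising3DConformalLimit.Theses.IsingEuclidUpgrade.IsingEuclidUpgradeR2RotInvPowerLaw ↔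
    (__Registered.stub_dyadicTowerLaw ∧
      Summit.CriticalPhenomena.Ising3DConformalLimit.Theses.BallOrbitComparison.TwoPointRegularVariation ∧
      __Registered.stub_vagueIsotropy) :=
  rotInvPowerLaw_iff_towerLaw_and_twoPointRegularVariation_and_vague

/-- T1 from the superseded line's rate stub S1 (landed p167127). -/
example
    (hS1 : ∃ Δ ω C : ℝ, 0 < ω ∧ ∀ n : ℕ, 1 ≤ n → |Literature.Probability.LatticeModels.criticalTwoPoint 3 (Pi.single 0 ((2 * n : ℕ) : ℤ)) * (4 : ℝ) ^ Δ / Literature.Probability.LatticeModels.criticalTwoPoint 3 (Pi.single 0 ((n : ℕ) : ℤ)) - 1| ≤ C * (n : ℝ) ^ (-ω)) :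
    __Registered.stub_dyadicTowerLaw :=
  towerLaw_of_dyadicDiniLaw hS1

end Summit.CriticalPhenomena.Ising3DConformalLimit.Cruxes.IsingEuclidUpgradeR2RotInvPowerLaw.TowerProfileRigidity

end
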